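import Mathlib
import HarnessLib
import Summits.NavierStokesRegularity.NavierStokesRegularity.Theorems.UnthreadedDoorNetFluxDefs

/-!
# Route `UnthreadedDoor`, crux `PoloidalLiouville` (stmt-NavierStokesRegularity-1222), WALL W1 — the named Type-I RESIDUAL after the
# third-stratum rung K3ᵃᵉ: `PersistentSheetResidualTypeI` (Theorems-side twin of ns-idea-14's `NullTime.PersistentSheetResidualTypeI`)

Statement-only file (no proofs).  After the rungs `unimodalScalarLiouvilleTypeI_holds` (p675773), `denseFiniteZeroScalarLiouvilleTypeI_holds`
(K3ᶠ, p684266) and `nullTimeDenseFiniteZeroScalarLiouvilleTypeI_holds` (K3ᵃᵉ, p688761), what is left of the Type-I side of the wall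
`stub_scalarLiouville` on this line is the PERSISTENT-SHEET configuration: the radii carrying infinitely many vorticity zeros on
`S_r(x₀)` fill an interval at times `t` that cannot be avoided by any closed Lebesgue-null set of times (and some sphere at some time is
not unimodal — the unimodal case is the first rung).  This file NAMES that residual Theorems-side, verbatim from the sketch
(`Cruxes/PoloidalLiouville/NullTimeSketch.lean` v1.2, `sphCrit` unfolded; `IsUnimodalSphere`, `CurledLaw` are the NetFluxDefs twins), so that
refuters and `cdisprove` seats can point at it; `typeI_unthreaded_dichotomy` / `multiHillScalarLiouvilleTypeI_of_persistentSheetResidual`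
(file `…TypeIDichotomy`) place it.  It is OPEN; no mechanism is claimed; nothing here bears on NS regularity (NOT proved).
-/

noncomputable section

-- the summit and its single sub-problem share the name (CONVENTIONS §1)
set_option linter.dupNamespace false

open Set Function MeasureTheory

namespace Summit.NavierStokesRegularity.NavierStokesRegularity.Theorems.PoloidalLiouville.NetFlux

open Literature.Analysis.FluidPDE

/-- **`PersistentSheetResidualTypeI` — the Type-I residual of W1 after K3ᵃᵉ** (twin of `NullTime.PersistentSheetResidualTypeI`, ns-idea-14 g5/g6):
for Type-I bounded ancient mild data unthreaded about `x₀` (representation `curl v = ∇T × (x − x₀)`, `T` bounded and smooth off `x₀`, curled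
law (E1)), IF for every closed Lebesgue-null set `D` of times there is a time `t ∉ D` and an interval of radii `(a,b)`, `0 < a`, on which every
sphere `S_r(x₀)` carries infinitely many vorticity zeros (a persistent vortex-null sheet), AND some sphere at some time is not unimodal, THEN
`∇T × (x − x₀) ≡ 0`.  OPEN; no mechanism claimed (the axisymmetric no-swirl class, known by KNSS 2009, is the model).  A route-posited
residual statement of this line (like `MultiHillScalarLiouvilleTypeI` in `UnthreadedDoorNetFluxDefs`), not a literature fact. -/
def PersistentSheetResidualTypeI : Prop :=
  ∀ (v : ℝ → E3 → E3) (x₀ : E3) (T : ℝ → E3 → ℝ),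
    (∃ C : ℝ, HasTypeITimeDecay C v) →
    IsBoundedAncientMildSolution 1 v →
    (∀ t < 0, AEStronglyMeasurable (v t) volume) →
    ContDiffOn ℝ (⊤ : ℕ∞) (uncurry v) (Iio 0 ×ˢ univ) →
    ContDiffOn ℝ (⊤ : ℕ∞) (uncurry T) (Iio 0 ×ˢ ({x₀}ᶜ : Set E3)) →
    (∃ C : ℝ, ∀ t < 0, ∀ x, |T t x| ≤ C) →
    (∀ t < 0, ∀ x, curl (v t) x = cross (gradient (T t) x) (x - x₀)) →
    CurledLaw v x₀ T (Iio 0) →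
    (∀ D : Set ℝ, IsClosed D → volume D = 0 →
      ∃ t < 0, t ∉ D ∧ ∃ a b : ℝ, 0 < a ∧ a < b ∧ ∀ r ∈ Ioo a b,
        {x : E3 | x ∈ Metric.sphere x₀ r ∧ cross (gradient (T t) x) (x - x₀) = 0}.Infinite) →
    (∃ t < 0, ∃ r > 0, ¬ IsUnimodalSphere (T t) x₀ r) →
    ∀ t < 0, ∀ x, cross (gradient (T t) x) (x - x₀) = 0

end Summit.NavierStokesRegularity.NavierStokesRegularity.Theorems.PoloidalLiouville.NetFlux
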